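import Summits.NavierStokesRegularity.NavierStokesRegularity.Theorems.AxisymmetricExtremalityAxisymmetricKatoGlobalStubSeregin2020TypeIILemma22EnergyClassAcrossAxisV3
import Summits.NavierStokesRegularity.NavierStokesRegularity.Theorems.AxisymmetricExtremalityAxisymmetricKatoGlobalStubSeregin2020TypeIILemma22ExcisionSchedule
import Summits.NavierStokesRegularity.NavierStokesRegularity.Theorems.AxisymmetricExtremalityAxisymmetricKatoGlobalStubSeregin2020TypeIILemma22ParabolicBumpIntegrals
import HarnessLib

/-!
# L22-B, piece F3c (2/·): the per-piece energy inequality across `S` for the normalised pair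

Seregin 2020 Lemma 2.2 ⇐ N–U 2012 Lemma 4.2 for the class `𝒱` (cell ns-inputs, kit A1-L22B-F3,
route P, step "F2′ verbatim on each closed time piece"):  fix a finite cover of
`S ∩ ([t₁,t₂] × B̄(0,2R))` by centred parabolic cylinders `Q*_{rᵢ}(zᵢ)` and a closed time piece
`[a,b] ⊆ [t₁,t₂]` containing no enlarged endpoint `tᵢ ± 2rᵢ²` in its interior.  Then every
`S`-point of `[a,b] × B̄(0,2R)` (CLOSED time interval) sits in the ball `B(xᵢ,rᵢ)` of a cylinder
ACTIVE during the piece (`exists_active_of_mem_Icc`), so the compact set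
`[a,b] × (B̄(0,2R) ∖ ⋃_{active} B(xᵢ,rᵢ))` misses the closed set `S`, hence so does a
`δ`-thickening of it: the open slab `]a-δ', b+δ'[ × O`, `O = B(0,2R) ∖ ⋃_{active} B̄(xᵢ,rᵢ)`, is
`S`-free, and the per-window inequality F2′ (`energyClass_ineq_acrossAxis_v3`, here in its REAL
form, taken as the hypothesis `hF2r` until that form lands) applies on `[a,b]` to every `C¹_c`
test function supported in `O` — no endpoint limits are needed.  The conclusion is rewritten for
the NORMALISED pair `Φ̃ = Φ` off `S` (`= k` on `S` and for `t ≥ 0`), `Ũ = U` off the axis (`= 0`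
on it) of kit A1 item 9: the two pairs agree a.e. on the slab (the axis is null) and have the same
spatial gradient off `S` (`S` is closed).  [cite: NazarovUraltseva2012, §3 (3.9), Remark 9;
Seregin2020, Lemma 2.2]

Nothing here is a Navier–Stokes regularity statement.
-/

noncomputable section

set_option linter.dupNamespace false

open MeasureTheory Set Function Filter Topology TopologicalSpace Metric
open scoped NNReal ENNReal InnerProductSpace RealInnerProductSpace

namespace Summit.NavierStokesRegularity.NavierStokesRegularity.Theorems.AxisymmetricKatoGlobal.EulerScaling

open Literature.Analysis.FluidPDE Literature.Analysis.FluidPDE.Seregin2020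

/-- **An `S`-free open slab around a closed step of the excision schedule.** If the cylinders
`Q*_{rᵢ}(zᵢ)`, `rᵢ > 0`, cover `S ∩ ([t₁,t₂] × B̄(0,ρ))`, `S` is closed, and the closed step
`[a,b] ⊆ [t₁,t₂]` has no enlarged endpoint `tᵢ ± 2rᵢ²` in its interior, then for some `δ > 0` no point
of `]a-δ, b+δ[ × (B(0,ρ) ∩ {rᵢ < dist x xᵢ for every ACTIVE i})` lies in `S`
(`exists_active_of_mem_Icc` + `exists_sFree_thickening` for the compact
`B̄(0,ρ) ∩ {rᵢ ≤ dist x xᵢ, i active}`). [folklore] -/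
theorem exists_sFree_slab_of_cover {S : Set (ℝ × EuclideanSpace ℝ (Fin 3))} (hSc : IsClosed S) {ρ t₁ t₂ : ℝ}
    {s : Finset ℕ} {z : ℕ → ℝ × EuclideanSpace ℝ (Fin 3)} {r : ℕ → ℝ}
    (hcov : S ∩ (Icc t₁ t₂ ×ˢ closedBall (0 : EuclideanSpace ℝ (Fin 3)) ρ) ⊆ ⋃ i ∈ s, parabolicCylinderCentered (r i) (z i))
    {a b : ℝ} (ha : t₁ ≤ a) (hab : a ≤ b) (hb : b ≤ t₂)
    (hpart : ∀ i ∈ s, (z i).1 - 2 * r i ^ 2 ∉ Ioo a b ∧ (z i).1 + 2 * r i ^ 2 ∉ Ioo a b) :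
    ∃ δ : ℝ, 0 < δ ∧ ∀ w : ℝ × EuclideanSpace ℝ (Fin 3), w.1 ∈ Ioo (a - δ) (b + δ) →
      w.2 ∈ ball (0 : EuclideanSpace ℝ (Fin 3)) ρ ∩
        {x | ∀ i ∈ s, ((z i).1 - 2 * r i ^ 2 ≤ a ∧ b ≤ (z i).1 + 2 * r i ^ 2) → r i < dist x (z i).2} →
      w ∉ S := by
  classical
  set act : ℕ → Prop := fun i => (z i).1 - 2 * r i ^ 2 ≤ a ∧ b ≤ (z i).1 + 2 * r i ^ 2 with hact
  set C : Set (EuclideanSpace ℝ (Fin 3)) := closedBall (0 : EuclideanSpace ℝ (Fin 3)) ρ ∩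
    {x | ∀ i ∈ s, act i → r i ≤ dist x (z i).2} with hC
  -- `C` is compact
  have hclosed : IsClosed {x : EuclideanSpace ℝ (Fin 3) | ∀ i ∈ s, act i → r i ≤ dist x (z i).2} := by
    have e : {x : EuclideanSpace ℝ (Fin 3) | ∀ i ∈ s, act i → r i ≤ dist x (z i).2} =
        ⋂ i ∈ s, {x | act i → r i ≤ dist x (z i).2} := by
      ext x; simp only [mem_setOf_eq, mem_iInter]
    rw [e]
    refine isClosed_biInter fun i _ => ?_
    by_cases hP : act i
    · simp only [hP, forall_true_left]
      exact isClosed_le continuous_const (continuous_id.dist continuous_const)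
    · simp only [hP, IsEmpty.forall_iff, setOf_true, isClosed_univ]
  have hCc : IsCompact C := (isCompact_closedBall _ _).inter_right hclosed
  -- no `S`-point of the closed step lies over `C`
  have hSC : ∀ w ∈ S, w.1 ∈ Icc a b → w.2 ∉ C := by
    intro w hwS hwt hwC
    obtain ⟨i, hi, hai, hdist⟩ := exists_active_of_mem_Icc hcov ha hb hpart hwS hwt hwC.1
    exact (lt_irrefl _) ((hwC.2 i hi hai).trans_lt hdist)
  obtain ⟨δ, hδ, hfree⟩ := exists_sFree_thickening hSc hab hCc hSC
  refine ⟨δ, hδ, fun w hwt hwx => hfree w hwt ?_⟩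
  refine self_subset_thickening hδ C ⟨ball_subset_closedBall hwx.1, fun i hi hai => (hwx.2 i hi hai).le⟩

/-- **The per-piece energy inequality across `S` for the normalised pair (real form).**
Class-`𝒱` data `(U, Φ, S)` (the binders of the crux item's `hWH′`), the normalised pair
`Φ̃ = Φ` on `{t<0} ∖ S`, `Ũ = U` on `{t<0} × {ϱ ≠ 0}` (only these two clauses of kit A1 item 9 are used); a finite cover
of `S ∩ ([t₁,t₂] × B̄(0,2R))` by `Q*_{rᵢ}(zᵢ)`; a closed step `[a,b] ⊆ [t₁,t₂] ⊆ ]-R²,0[` free of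
enlarged endpoints in its interior; `H, η` as in `EnergyClass`; a `C¹_c` test function `Ψ` supported
in `B(0,2R)` away from the closed balls `B̄(xᵢ,rᵢ)` of the active cylinders.  GIVEN the real form of
the per-window inequality F2′ (`hF2r`; = `energyClass_ineq_acrossAxis_v3` with conclusion
"dissipation finite ∧ real inequality"), the same real inequality holds on `[a,b]` for `(Φ̃, Ũ, Ψ)`.
[cite: NazarovUraltseva2012, §3 (3.9), Remark 9; Seregin2020, Lemma 2.2] -/
theorem pieceEnergy_real
    (hF2r : ∀ (O : Set (EuclideanSpace ℝ (Fin 3))), IsOpen O → ∀ (lo hi : ℝ)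
      (Φ : ℝ → EuclideanSpace ℝ (Fin 3) → ℝ) (U : ℝ → EuclideanSpace ℝ (Fin 3) → EuclideanSpace ℝ (Fin 3)),
      ContinuousOn (uncurry Φ) (Ioo lo hi ×ˢ O) →
      ContinuousOn (fun z : ℝ × EuclideanSpace ℝ (Fin 3) => fderiv ℝ (Φ z.1) z.2) (Ioo lo hi ×ˢ O) →
      (∀ z ∈ Ioo lo hi ×ˢ (O ∩ {x | cylRadius x ≠ 0}), ContDiffAt ℝ 2 (Φ z.1) z.2) →
      (∀ z ∈ Ioo lo hi ×ˢ (O ∩ {x | cylRadius x ≠ 0}), DifferentiableAt ℝ (fun r => Φ r z.2) z.1) →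
      ContinuousOn (fun z : ℝ × EuclideanSpace ℝ (Fin 3) => deriv (fun r => Φ r z.2) z.1)
        (Ioo lo hi ×ˢ (O ∩ {x | cylRadius x ≠ 0})) →
      ContinuousOn (uncurry U) (Ioo lo hi ×ˢ (O ∩ {x | cylRadius x ≠ 0})) →
      (∀ z ∈ Ioo lo hi ×ˢ (O ∩ {x | cylRadius x ≠ 0}), ContDiffAt ℝ 1 (U z.1) z.2) →
      (∀ z ∈ Ioo lo hi ×ˢ (O ∩ {x | cylRadius x ≠ 0}), VectorCalculus.divergence (U z.1) z.2 = 0) →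
      (∫⁻ z in Ioo lo hi ×ˢ O, ‖U z.1 z.2‖ₑ ^ (3 : ℕ)) < ⊤ →
      (∀ z ∈ Ioo lo hi ×ˢ (O ∩ {x | cylRadius x ≠ 0}), 0 ≤ deriv (fun r => Φ r z.2) z.1 +
        fderiv ℝ (Φ z.1) z.2 (U z.1 z.2) + 2 / cylRadius z.2 * partialDeriv (eR z.2) (Φ z.1) z.2 -
        (Laplacian.laplacian (Φ z.1)) z.2) →
      ∀ (k : ℝ), (∀ z ∈ Ioo lo hi ×ˢ O, cylRadius z.2 = 0 → k ≤ Φ z.1 z.2) →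
      ∀ (H : ℝ → ℝ), ContDiff ℝ 2 H → (∀ v, deriv H v ≤ 0) → (∀ v, 0 ≤ H v) →
        (∀ v, 0 ≤ deriv (deriv H) v) → (∀ v, deriv H v ^ 2 ≤ 2 * H v * deriv (deriv H) v) →
        (∀ v, k ≤ v → H v = 0) →
      ∀ (Θ : EuclideanSpace ℝ (Fin 3) → ℝ), ContDiff ℝ 1 Θ → HasCompactSupport Θ → tsupport Θ ⊆ O →
      ∀ (η : ℝ → ℝ), ContDiff ℝ 1 η → (∀ s, 0 ≤ η s) →
      ∀ (t₁ t : ℝ), lo < t₁ → t₁ ≤ t → t < hi →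
        (∫⁻ z in Icc t₁ t ×ˢ (univ : Set (EuclideanSpace ℝ (Fin 3))), ENNReal.ofReal
            (1 / 2 * η z.1 * (deriv (deriv H) (Φ z.1 z.2) * ‖gradient (Φ z.1) z.2‖ ^ 2 * Θ z.2 ^ 2))) < ⊤ ∧
        η t * (∫ x, H (Φ t x) * Θ x ^ 2) +
          (∫⁻ z in Icc t₁ t ×ˢ (univ : Set (EuclideanSpace ℝ (Fin 3))), ENNReal.ofReal
            (1 / 2 * η z.1 * (deriv (deriv H) (Φ z.1 z.2) * ‖gradient (Φ z.1) z.2‖ ^ 2 * Θ z.2 ^ 2))).toReal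
        ≤ η t₁ * (∫ x, H (Φ t₁ x) * Θ x ^ 2) +
          (4 * ∫ z in Icc t₁ t ×ˢ (univ : Set (EuclideanSpace ℝ (Fin 3))),
            η z.1 * (H (Φ z.1 z.2) * ‖gradient Θ z.2‖ ^ 2)) +
          (∫ z in Icc t₁ t ×ˢ (univ : Set (EuclideanSpace ℝ (Fin 3))),
            η z.1 * (H (Φ z.1 z.2) * inner ℝ (U z.1 z.2) (gradient (fun y => Θ y ^ 2) z.2))) +
          (∫ z in Icc t₁ t ×ˢ (univ : Set (EuclideanSpace ℝ (Fin 3))),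
            η z.1 * (2 / cylRadius z.2 * (H (Φ z.1 z.2) * fderiv ℝ (fun y => Θ y ^ 2) z.2 (eR z.2)))) +
          (∫ z in Icc t₁ t ×ˢ (univ : Set (EuclideanSpace ℝ (Fin 3))), |deriv η z.1| * (H (Φ z.1 z.2) * Θ z.2 ^ 2)))
    -- class-𝒱 data
    {U : ℝ → EuclideanSpace ℝ (Fin 3) → EuclideanSpace ℝ (Fin 3)} {Φ : ℝ → EuclideanSpace ℝ (Fin 3) → ℝ}
    {S : Set (ℝ × EuclideanSpace ℝ (Fin 3))} {R k : ℝ}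
    (hUc : ContinuousOn (uncurry U) {z : ℝ × EuclideanSpace ℝ (Fin 3) | z.1 < 0 ∧ cylRadius z.2 ≠ 0})
    (hUs : ∀ z : ℝ × EuclideanSpace ℝ (Fin 3), z.1 < 0 → cylRadius z.2 ≠ 0 → ContDiffAt ℝ (⊤ : ℕ∞) (U z.1) z.2)
    (hdivU : ∀ z : ℝ × EuclideanSpace ℝ (Fin 3), z.1 < 0 → cylRadius z.2 ≠ 0 →
      VectorCalculus.divergence (U z.1) z.2 = 0)
    (hU3 : ∀ a : ℝ, 0 < a → ∫⁻ z in parabolicCylinder a (0 : ℝ × EuclideanSpace ℝ (Fin 3)), ‖U z.1 z.2‖ₑ ^ (3 : ℕ) < ∞)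
    (hSc : IsClosed S) (hSax : ∀ z ∈ S, z.1 ≤ 0 ∧ cylRadius z.2 = 0)
    (hΦc : ContinuousOn (uncurry Φ) ({z : ℝ × EuclideanSpace ℝ (Fin 3) | z.1 < 0} \ S))
    (hΦs : ∀ z : ℝ × EuclideanSpace ℝ (Fin 3), z.1 < 0 → z ∉ S → ContDiffAt ℝ (⊤ : ℕ∞) (Φ z.1) z.2)
    (hΦg : ContinuousOn (fun z : ℝ × EuclideanSpace ℝ (Fin 3) => fderiv ℝ (Φ z.1) z.2)
      ({z : ℝ × EuclideanSpace ℝ (Fin 3) | z.1 < 0} \ S))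
    (hΦt : ∀ z : ℝ × EuclideanSpace ℝ (Fin 3), z.1 < 0 → cylRadius z.2 ≠ 0 → DifferentiableAt ℝ (fun r => Φ r z.2) z.1)
    (hΦt' : ContinuousOn (fun z : ℝ × EuclideanSpace ℝ (Fin 3) => deriv (fun r => Φ r z.2) z.1)
      {z : ℝ × EuclideanSpace ℝ (Fin 3) | z.1 < 0 ∧ cylRadius z.2 ≠ 0})
    (hsup : ∀ z : ℝ × EuclideanSpace ℝ (Fin 3), z.1 < 0 → cylRadius z.2 ≠ 0 →
      0 ≤ deriv (fun r => Φ r z.2) z.1 + fderiv ℝ (Φ z.1) z.2 (U z.1 z.2) +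
          2 / cylRadius z.2 * partialDeriv (eR z.2) (Φ z.1) z.2 - (Laplacian.laplacian (Φ z.1)) z.2)
    (hR : 0 < R)
    (hk : ∀ z : ℝ × EuclideanSpace ℝ (Fin 3), z.1 ∈ Ioo (-R ^ 2) 0 → cylRadius z.2 = 0 →
      z.2 2 ∈ Ioo (-(2 * R)) (2 * R) → z ∉ S → k ≤ Φ z.1 z.2)
    -- the normalised pair
    {Φ' : ℝ → EuclideanSpace ℝ (Fin 3) → ℝ} {U' : ℝ → EuclideanSpace ℝ (Fin 3) → EuclideanSpace ℝ (Fin 3)}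
    (hΦ' : ∀ t x, t < 0 → (t, x) ∉ S → Φ' t x = Φ t x)
    (hU' : ∀ t x, t < 0 → cylRadius x ≠ 0 → U' t x = U t x)
    -- the cover and the piece
    {s : Finset ℕ} {z : ℕ → ℝ × EuclideanSpace ℝ (Fin 3)} {r : ℕ → ℝ}
    {t₁ t₂ : ℝ} (ht₁ : -R ^ 2 < t₁) (ht₂ : t₂ < 0)
    (hcov : S ∩ (Icc t₁ t₂ ×ˢ closedBall (0 : EuclideanSpace ℝ (Fin 3)) (2 * R)) ⊆
      ⋃ i ∈ s, parabolicCylinderCentered (r i) (z i))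
    {a b : ℝ} (ha : t₁ ≤ a) (hab : a ≤ b) (hb : b ≤ t₂)
    (hpart : ∀ i ∈ s, (z i).1 - 2 * r i ^ 2 ∉ Ioo a b ∧ (z i).1 + 2 * r i ^ 2 ∉ Ioo a b)
    -- the profile, the test function of the piece, the time weight
    {H : ℝ → ℝ} (hH : ContDiff ℝ 2 H) (hH' : ∀ v, deriv H v ≤ 0) (hH0 : ∀ v, 0 ≤ H v)
    (hH2 : ∀ v, 0 ≤ deriv (deriv H) v) (hκ : ∀ v, deriv H v ^ 2 ≤ 2 * H v * deriv (deriv H) v)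
    (hHk : ∀ v, k ≤ v → H v = 0)
    {Ψ : EuclideanSpace ℝ (Fin 3) → ℝ} (hΨ : ContDiff ℝ 1 Ψ) (hΨc : HasCompactSupport Ψ)
    (hΨO : tsupport Ψ ⊆ ball (0 : EuclideanSpace ℝ (Fin 3)) (2 * R) ∩
      {x | ∀ i ∈ s, ((z i).1 - 2 * r i ^ 2 ≤ a ∧ b ≤ (z i).1 + 2 * r i ^ 2) → r i < dist x (z i).2})
    {η : ℝ → ℝ} (hη : ContDiff ℝ 1 η) (hη0 : ∀ s, 0 ≤ η s) :
    (∫⁻ w in Icc a b ×ˢ (univ : Set (EuclideanSpace ℝ (Fin 3))), ENNReal.ofReal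
        (1 / 2 * η w.1 * (deriv (deriv H) (Φ' w.1 w.2) * ‖gradient (Φ' w.1) w.2‖ ^ 2 * Ψ w.2 ^ 2))) < ⊤ ∧
    η b * (∫ x, H (Φ' b x) * Ψ x ^ 2) +
      (∫⁻ w in Icc a b ×ˢ (univ : Set (EuclideanSpace ℝ (Fin 3))), ENNReal.ofReal
        (1 / 2 * η w.1 * (deriv (deriv H) (Φ' w.1 w.2) * ‖gradient (Φ' w.1) w.2‖ ^ 2 * Ψ w.2 ^ 2))).toReal
    ≤ η a * (∫ x, H (Φ' a x) * Ψ x ^ 2) +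
      (4 * ∫ w in Icc a b ×ˢ (univ : Set (EuclideanSpace ℝ (Fin 3))),
        η w.1 * (H (Φ' w.1 w.2) * ‖gradient Ψ w.2‖ ^ 2)) +
      (∫ w in Icc a b ×ˢ (univ : Set (EuclideanSpace ℝ (Fin 3))),
        η w.1 * (H (Φ' w.1 w.2) * inner ℝ (U' w.1 w.2) (gradient (fun y => Ψ y ^ 2) w.2))) +
      (∫ w in Icc a b ×ˢ (univ : Set (EuclideanSpace ℝ (Fin 3))),
        η w.1 * (2 / cylRadius w.2 * (H (Φ' w.1 w.2) * fderiv ℝ (fun y => Ψ y ^ 2) w.2 (eR w.2)))) +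
      (∫ w in Icc a b ×ˢ (univ : Set (EuclideanSpace ℝ (Fin 3))), |deriv η w.1| * (H (Φ' w.1 w.2) * Ψ w.2 ^ 2)) := by
  classical
  set act : ℕ → Prop := fun i => (z i).1 - 2 * r i ^ 2 ≤ a ∧ b ≤ (z i).1 + 2 * r i ^ 2 with hact
  set O : Set (EuclideanSpace ℝ (Fin 3)) := ball (0 : EuclideanSpace ℝ (Fin 3)) (2 * R) ∩
    {x | ∀ i ∈ s, act i → r i < dist x (z i).2} with hO
  have hOo : IsOpen O := isOpen_activeDomain s act (fun i => (z i).2) r isOpen_ball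
  -- ### the `S`-free open slab
  obtain ⟨δ, hδ, hfree⟩ := exists_sFree_slab_of_cover hSc hcov ha hab hb hpart
  set δ' : ℝ := min δ (min (t₁ + R ^ 2) (-t₂)) / 2 with hδ'
  have hδ'0 : 0 < δ' := by
    rw [hδ']; refine div_pos (lt_min hδ (lt_min (by linarith) (by linarith))) two_pos
  have hδ'δ : δ' < δ := by
    rw [hδ']
    have := min_le_left δ (min (t₁ + R ^ 2) (-t₂)); linarith
  have hδ'1 : δ' < t₁ + R ^ 2 := by
    rw [hδ']
    have h1 := min_le_right δ (min (t₁ + R ^ 2) (-t₂))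
    have h2 := min_le_left (t₁ + R ^ 2) (-t₂)
    have h3 : 0 < min δ (min (t₁ + R ^ 2) (-t₂)) := lt_min hδ (lt_min (by linarith) (by linarith))
    linarith
  have hδ'2 : δ' < -t₂ := by
    rw [hδ']
    have h1 := min_le_right δ (min (t₁ + R ^ 2) (-t₂))
    have h2 := min_le_right (t₁ + R ^ 2) (-t₂)
    have h3 : 0 < min δ (min (t₁ + R ^ 2) (-t₂)) := lt_min hδ (lt_min (by linarith) (by linarith))
    linarith
  set lo : ℝ := a - δ' with hlo
  set hi : ℝ := b + δ' with hhi
  have hlo1 : -R ^ 2 < lo := by rw [hlo]; linarith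
  have hhi0 : hi < 0 := by rw [hhi]; linarith
  have hW_S : ∀ w : ℝ × EuclideanSpace ℝ (Fin 3), w ∈ Ioo lo hi ×ˢ O → w ∉ S := by
    intro w hw
    exact hfree w ⟨by linarith [hw.1.1], by linarith [hw.1.2]⟩ hw.2
  have hWneg : ∀ w : ℝ × EuclideanSpace ℝ (Fin 3), w ∈ Ioo lo hi ×ˢ O → w.1 < 0 :=
    fun w hw => hw.1.2.trans hhi0
  have hWsub : Ioo lo hi ×ˢ O ⊆ {w : ℝ × EuclideanSpace ℝ (Fin 3) | w.1 < 0} \ S :=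
    fun w hw => ⟨hWneg w hw, hW_S w hw⟩
  have hWax : Ioo lo hi ×ˢ (O ∩ {x | cylRadius x ≠ 0}) ⊆
      {w : ℝ × EuclideanSpace ℝ (Fin 3) | w.1 < 0 ∧ cylRadius w.2 ≠ 0} :=
    fun w hw => ⟨hw.1.2.trans hhi0, hw.2.2⟩
  -- ### the F2′ hypotheses on the slab, for the raw pair
  have hU3' : (∫⁻ w in Ioo lo hi ×ˢ O, ‖U w.1 w.2‖ₑ ^ (3 : ℕ)) < ⊤ := by
    refine lt_of_le_of_lt (lintegral_mono_set ?_) (hU3 (2 * R) (by linarith))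
    intro w hw
    simp only [parabolicCylinder, mem_prod, mem_Ioo, Prod.fst_zero, Prod.snd_zero] at hw ⊢
    have h1 : (0 : ℝ) - (2 * R) ^ 2 < w.1 := by nlinarith [hw.1.1, hlo1, sq_nonneg R]
    exact ⟨⟨h1, hw.1.2.trans hhi0⟩, hw.2.1⟩
  have hk' : ∀ w ∈ Ioo lo hi ×ˢ O, cylRadius w.2 = 0 → k ≤ Φ w.1 w.2 := by
    intro w hw hρ
    have hx : w.2 ∈ ball (0 : EuclideanSpace ℝ (Fin 3)) (2 * R) := hw.2.1
    rw [mem_ball_zero_iff] at hx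
    have h2 : |w.2 2| < 2 * R := (abs_apply_le_norm_fin3 w.2 2).trans_lt hx
    exact hk w (⟨by linarith [hw.1.1], hWneg w hw⟩ : w.1 ∈ Ioo (-R ^ 2) 0) hρ (abs_lt.1 h2) (hW_S w hw)
  obtain ⟨hfin, hineq⟩ := hF2r O hOo lo hi Φ U (hΦc.mono hWsub) (hΦg.mono hWsub)
    (fun w hw => (hΦs w (hWax hw).1 (hW_S w (⟨hw.1, hw.2.1⟩ : w ∈ Ioo lo hi ×ˢ O))).of_le (by norm_cast))
    (fun w hw => hΦt w (hWax hw).1 (hWax hw).2) (hΦt'.mono hWax) (hUc.mono hWax)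
    (fun w hw => (hUs w (hWax hw).1 (hWax hw).2).of_le (by norm_cast))
    (fun w hw => hdivU w (hWax hw).1 (hWax hw).2) hU3'
    (fun w hw => hsup w (hWax hw).1 (hWax hw).2) k hk' H hH hH' hH0 hH2 hκ hHk Ψ hΨ hΨc hΨO η hη hη0
    a b (by rw [hlo]; linarith) hab (by rw [hhi]; linarith)
  -- ### the raw and the normalised pair agree a.e. on `[a,b] × ℝ³`
  have hslice : ∀ t ∈ Icc a b, (∫ x, H (Φ t x) * Ψ x ^ 2) = ∫ x, H (Φ' t x) * Ψ x ^ 2 := by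
    intro t ht
    have htneg : t < 0 := lt_of_le_of_lt (ht.2.trans hb) ht₂
    refine integral_congr_ae ?_
    have hax : ∀ᵐ x : EuclideanSpace ℝ (Fin 3), cylRadius x ≠ 0 := by
      have := measure_eq_zero_iff_ae_notMem.1 volume_setOf_cylRadius_eq_zero
      filter_upwards [this] with x hx using hx
    filter_upwards [hax] with x hx
    have hxS : (t, x) ∉ S := fun h => hx (hSax _ h).2
    rw [hΦ' t x htneg hxS]
  have hae : ∀ᵐ w ∂(volume.restrict (Icc a b ×ˢ (univ : Set (EuclideanSpace ℝ (Fin 3))))),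
      Φ' w.1 w.2 = Φ w.1 w.2 ∧ U' w.1 w.2 = U w.1 w.2 ∧ gradient (Φ' w.1) w.2 = gradient (Φ w.1) w.2 := by
    rw [restrict_Icc_prod_univ_eq_restrict_Ioc_prod]
    filter_upwards [ae_fst_mem_Ioc a b, ae_prod_cylRadius_ne_zero a b] with w hw hρ
    have htneg : w.1 < 0 := lt_of_le_of_lt (hw.2.trans hb) ht₂
    have hwS : w ∉ S := fun h => hρ (hSax _ h).2
    refine ⟨hΦ' w.1 w.2 htneg hwS, hU' w.1 w.2 htneg hρ, ?_⟩
    refine Filter.EventuallyEq.gradient_eq ?_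
    have hopen : IsOpen {y : EuclideanSpace ℝ (Fin 3) | (w.1, y) ∉ S} :=
      (hSc.preimage (Continuous.prodMk_right w.1)).isOpen_compl
    filter_upwards [hopen.mem_nhds (show w.2 ∈ {y | (w.1, y) ∉ S} from hwS)] with y hy
    exact hΦ' w.1 y htneg hy
  have hL : (∫⁻ w in Icc a b ×ˢ (univ : Set (EuclideanSpace ℝ (Fin 3))), ENNReal.ofReal
        (1 / 2 * η w.1 * (deriv (deriv H) (Φ' w.1 w.2) * ‖gradient (Φ' w.1) w.2‖ ^ 2 * Ψ w.2 ^ 2))) =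
      ∫⁻ w in Icc a b ×ˢ (univ : Set (EuclideanSpace ℝ (Fin 3))), ENNReal.ofReal
        (1 / 2 * η w.1 * (deriv (deriv H) (Φ w.1 w.2) * ‖gradient (Φ w.1) w.2‖ ^ 2 * Ψ w.2 ^ 2)) := by
    refine lintegral_congr_ae ?_
    filter_upwards [hae] with w hw
    rw [hw.1, hw.2.2]
  have hI1 : (∫ w in Icc a b ×ˢ (univ : Set (EuclideanSpace ℝ (Fin 3))),
        η w.1 * (H (Φ' w.1 w.2) * ‖gradient Ψ w.2‖ ^ 2)) =
      ∫ w in Icc a b ×ˢ (univ : Set (EuclideanSpace ℝ (Fin 3))), η w.1 * (H (Φ w.1 w.2) * ‖gradient Ψ w.2‖ ^ 2) := by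
    refine integral_congr_ae ?_
    filter_upwards [hae] with w hw
    rw [hw.1]
  have hI2 : (∫ w in Icc a b ×ˢ (univ : Set (EuclideanSpace ℝ (Fin 3))),
        η w.1 * (H (Φ' w.1 w.2) * inner ℝ (U' w.1 w.2) (gradient (fun y => Ψ y ^ 2) w.2))) =
      ∫ w in Icc a b ×ˢ (univ : Set (EuclideanSpace ℝ (Fin 3))),
        η w.1 * (H (Φ w.1 w.2) * inner ℝ (U w.1 w.2) (gradient (fun y => Ψ y ^ 2) w.2)) := by
    refine integral_congr_ae ?_
    filter_upwards [hae] with w hw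
    rw [hw.1, hw.2.1]
  have hI3 : (∫ w in Icc a b ×ˢ (univ : Set (EuclideanSpace ℝ (Fin 3))),
        η w.1 * (2 / cylRadius w.2 * (H (Φ' w.1 w.2) * fderiv ℝ (fun y => Ψ y ^ 2) w.2 (eR w.2)))) =
      ∫ w in Icc a b ×ˢ (univ : Set (EuclideanSpace ℝ (Fin 3))),
        η w.1 * (2 / cylRadius w.2 * (H (Φ w.1 w.2) * fderiv ℝ (fun y => Ψ y ^ 2) w.2 (eR w.2))) := by
    refine integral_congr_ae ?_
    filter_upwards [hae] with w hw
    rw [hw.1]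
  have hI4 : (∫ w in Icc a b ×ˢ (univ : Set (EuclideanSpace ℝ (Fin 3))), |deriv η w.1| * (H (Φ' w.1 w.2) * Ψ w.2 ^ 2)) =
      ∫ w in Icc a b ×ˢ (univ : Set (EuclideanSpace ℝ (Fin 3))), |deriv η w.1| * (H (Φ w.1 w.2) * Ψ w.2 ^ 2) := by
    refine integral_congr_ae ?_
    filter_upwards [hae] with w hw
    rw [hw.1]
  rw [hL, hI1, hI2, hI3, hI4, ← hslice a ⟨le_rfl, hab⟩, ← hslice b ⟨hab, le_rfl⟩]
  exact ⟨hfin, hineq⟩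

end Summit.NavierStokesRegularity.NavierStokesRegularity.Theorems.AxisymmetricKatoGlobal.EulerScaling

end
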